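import Summits.PneNP.PneNP.Theorems.ExpanderLinearGeneratorsResKCaseOne
import HarnessLib

/-!
# The `Res(k)` rung for expanding linear systems, IX: the switching lemma

Support file for `stmt-PneNP-11443`. The Segerlind–Buss–Impagliazzo switching lemma for the
expansion-preserving restriction `rho` (file VII), by induction on the term size `i ≤ k`
(`2k ≤ c`): with the heights `hgt M i T` (`hgt M 0 T = 0`,
`hgt M (i+1) T = (i+1)·s + hgt M i (T + (i+1)·s + 1)`, `s = 2^{i+2} M^{i+1} T`), for every `i`-DNF
`F` on variables `< V`,

  `#{(u, y) : u good and F has NO strong decision tree of height ≤ hgt M i T under rho u y}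
     ≤ M^V · 2^V · 2^{-T}`                                             (`card_bad_le`).

Either `F` has `s` pairwise disjoint consistent terms — then a bad point satisfies none of them,
and file VIII bounds these by `M^V 2^V (1 - 2^{-(i+2)} M^{-(i+1)})^s ≤ M^V 2^V e^{-T}` — or a set
`C` of at most `(i+1)s` variables meets every consistent term, and a bad point for `F` is bad for
one of the `2^{|C|}` restricted `i`-DNFs `restrictDNF β C F` at the larger target `T + (i+1)s + 1`
(file III: query `C`, then use the tree of the restricted DNF), so the induction hypothesis and a
union bound over `β` give `2^{|C|} · M^V 2^V 2^{-(T + (i+1)s + 1)} ≤ M^V 2^V 2^{-T-1}`.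

[Segerlind–Buss–Impagliazzo 2004, §3, Thm. 3.x (switching lemma for small restrictions);
Alekhnovich 2011, §4]
-/

namespace Summit.PneNP.PneNP.Theorems.ResKRestriction

open Finset Literature.Computability.Complexity Literature.Computability.MetaComplexity

variable {m n : ℕ} {E : Fin m → LinEqMod 2 n} {r c : ℝ} {V M : ℕ}

/-! ### Parameters -/

/-- The number of disjoint terms used at level `j`: `s = 2^{j+1} M^j T`. [folklore] -/
def sPar (M j T : ℕ) : ℕ :=
  2 ^ (j + 1) * M ^ j * T

/-- The height of the strong decision trees at level `i` for target exponent `T`.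
[Segerlind–Buss–Impagliazzo 2004, §3] [folklore] -/
def hgt (M : ℕ) : ℕ → ℕ → ℕ
  | 0, _ => 0
  | i + 1, T => (i + 1) * sPar M (i + 1) T + hgt M i (T + (i + 1) * sPar M (i + 1) T + 1)

/-! ### Restricting by a total assignment of the cover -/

/-- Extend `β : C → Bool` to all of `ℕ` (by `false`). [folklore] -/
def extC (C : Finset ℕ) (β : C → Bool) : ℕ → Bool :=
  fun x => if h : x ∈ C then β ⟨x, h⟩ else false

/-- `restrictDNF` only reads the assignment on `C`. [folklore] -/
theorem restrictDNF_congr {β β' : ℕ → Bool} {C : Finset ℕ} (h : ∀ x ∈ C, β x = β' x)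
    (F : Finset (Finset (Literal ℕ))) : restrictDNF β C F = restrictDNF β' C F := by
  unfold restrictDNF
  congr 1
  refine Finset.filter_congr fun t _ => ?_
  refine and_congr Iff.rfl (forall₂_congr fun l _ => ?_)
  constructor
  · intro h1 h2; rw [← h l.1 h2]; exact h1 h2
  · intro h1 h2; rw [h l.1 h2]; exact h1 h2

/-- `fillIn ρ C π` extends `ρ`. [folklore] -/
theorem extends_fillIn (ρ : ℕ → Option Bool) (C : Finset ℕ) (π : ℕ → Bool) :
    Extends ρ (fillIn ρ C π) := by
  intro x b hx
  by_cases hxC : x ∈ C <;> simp [fillIn, hxC, hx]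

/-- `fillIn ρ C π` assigns every variable of `C`. [folklore] -/
theorem fillIn_isSome {ρ : ℕ → Option Bool} {C : Finset ℕ} (π : ℕ → Bool) {x : ℕ} (hx : x ∈ C) :
    ∃ b, fillIn ρ C π x = some b := by
  cases h : ρ x with
  | none => exact ⟨π x, by simp [fillIn, hx, h]⟩
  | some b => exact ⟨b, by simp [fillIn, hx, h]⟩

/-- **Strong trees from the restricted DNFs.** If for every total assignment `β` of the cover
`C` the restricted DNF `restrictDNF (extC C β) C F` has a strong tree of height `≤ h` under `ρ`,
then `F` has one of height `≤ h + |C|` (query the free variables of `C`, file III).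
[Segerlind–Buss–Impagliazzo 2004, §3] [folklore] -/
theorem ev_of_forall_restrictDNF {F : Finset (Finset (Literal ℕ))} {C : Finset ℕ}
    {ρ : ℕ → Option Bool} {h : ℕ} (hall : ∀ β : C → Bool, Ev (restrictDNF (extC C β) C F) ρ h) :
    Ev F ρ (h + C.card) := by
  refine ev_of_forall_fillIn C fun π => ?_
  set α := fillIn ρ C π with hα
  let βπ : ℕ → Bool := fun x => (α x).getD false
  have hagree : AgreesOn α βπ C := by
    intro x hx
    obtain ⟨b, hb⟩ := fillIn_isSome (ρ := ρ) π hx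
    have hb' : α x = some b := hb
    show α x = some ((α x).getD false)
    rw [hb']; rfl
  have hev := hall fun x : C => βπ x
  rw [restrictDNF_congr (β' := βπ) (fun x hx => by simp [extC, hx]) F] at hev
  exact (hev.of_extends (extends_fillIn ρ C π)).of_restrictDNF hagree

/-! ### The bad set -/

section Bad

variable (E : Fin m → LinEqMod 2 n) (r c : ℝ) (V M : ℕ)

/-- The BAD sample points for the DNF `F` at height `H`: good points under which `F` has no strong
decision tree of height `≤ H`. [Segerlind–Buss–Impagliazzo 2004, §3] [folklore] -/
noncomputable def badSet (F : Finset (Finset (Literal ℕ))) (H : ℕ) :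
    Finset ((Fin V → Fin M) × (Fin V → Bool)) :=
  @Finset.filter _
    (fun p : (Fin V → Fin M) × (Fin V → Bool) =>
      Good (n := n) r c V M p.1 ∧ ¬ Ev F (rho E r c V M p.1 p.2) H)
    (fun _ => Classical.propDecidable _)
    (Finset.univ : Finset ((Fin V → Fin M) × (Fin V → Bool)))

variable {E r c V M}

/-- Membership in the bad set. [folklore] -/
theorem mem_badSet {F : Finset (Finset (Literal ℕ))} {H : ℕ} {p : (Fin V → Fin M) × (Fin V → Bool)} :
    p ∈ badSet E r c V M F H ↔ Good (n := n) r c V M p.1 ∧ ¬ Ev F (rho E r c V M p.1 p.2) H := by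
  unfold badSet
  simp only [Finset.mem_filter, Finset.mem_univ, true_and]

/-- The bad set is monotone decreasing in the height. [folklore] -/
theorem badSet_mono {F : Finset (Finset (Literal ℕ))} {H H' : ℕ} (hH : H ≤ H') :
    badSet (n := n) E r c V M F H' ⊆ badSet E r c V M F H := by
  intro p hp
  rw [mem_badSet] at hp ⊢
  exact ⟨hp.1, fun h => hp.2 (h.mono hH)⟩

end Bad

/-! ### The switching lemma -/

section Switching

variable (hexp : IsBoundaryExpander (rowVars E) r c) (hc : 0 < c) (hnV : n ≤ V) (hM : 1 ≤ M)
  {k : ℕ} (hkc : 2 * (k : ℝ) ≤ c)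
include hexp hc hnV hM hkc

/-- **The switching lemma for the expansion-preserving restriction.** For every `i ≤ k`, target
`T` and `i`-DNF `F` on variables `< V`:
`#bad(F, hgt M i T) ≤ M^V · 2^V · 2^{-T}`. [Segerlind–Buss–Impagliazzo 2004, §3 (switching lemma);
Alekhnovich 2011, §4, Lemma 4.x] [folklore] -/
theorem card_badSet_le : ∀ i, i ≤ k → ∀ (T : ℕ) (F : Finset (Finset (Literal ℕ))),
    IsKDNF i F → (∀ t ∈ F, ∀ l ∈ t, l.1 < V) →
    ((badSet (n := n) E r c V M F (hgt M i T)).card : ℝ) ≤ (M : ℝ) ^ V * (2 : ℝ) ^ V * ((2 : ℝ) ^ T)⁻¹ := by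
  intro i
  induction i with
  | zero =>
    intro _ T F hF _
    -- a `0`-DNF is `∅` or `{∅}`: it always has a strong tree of height `0`
    have hempty : badSet (n := n) E r c V M F (hgt M 0 T) = ∅ := by
      ext p
      simp only [Finset.notMem_empty, iff_false, mem_badSet, not_and, not_not]
      intro _
      by_cases h0 : (∅ : Finset (Literal ℕ)) ∈ F
      · exact ev_of_empty_mem h0 _ _
      · refine Ev.zero fun t ht _ => ?_
        have := hF t ht
        have : t = ∅ := Finset.card_eq_zero.1 (by omega)
        subst this; exact absurd ht h0
    rw [hempty, Finset.card_empty, Nat.cast_zero]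
    positivity
  | succ i ih =>
    intro hik T F hF hFV
    have hi : i ≤ k := by omega
    set s := sPar M (i + 1) T with hs
    set T' := T + (i + 1) * s + 1 with hT'
    have hH : hgt M (i + 1) T = (i + 1) * s + hgt M i T' := rfl
    have hbase : (0 : ℝ) ≤ (M : ℝ) ^ V * (2 : ℝ) ^ V * ((2 : ℝ) ^ T)⁻¹ := by positivity
    -- the DNF containing the empty term is never bad
    by_cases h0 : (∅ : Finset (Literal ℕ)) ∈ F
    · have hempty : badSet (n := n) E r c V M F (hgt M (i + 1) T) = ∅ := by
        ext p
        simp only [Finset.notMem_empty, iff_false, mem_badSet, not_and, not_not]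
        exact fun _ => ev_of_empty_mem h0 _ _
      rw [hempty, Finset.card_empty, Nat.cast_zero]
      exact hbase
    rcases exists_disjoint_or_cover (s := s) hF h0 with ⟨D, hDF, hDcard, hDdisj, hDcons⟩ | ⟨C, hCcard, hCcov⟩
    · -- (a) `s` disjoint consistent terms: a bad point satisfies none of them
      have hsub : badSet (n := n) E r c V M F (hgt M (i + 1) T) ⊆
          (Finset.univ : Finset ((Fin V → Fin M) × (Fin V → Bool))).filter
            fun p : (Fin V → Fin M) × (Fin V → Bool) =>
              Good (n := n) r c V M p.1 ∧ ∀ t ∈ D, ¬ SatBy (rho E r c V M p.1 p.2) t := by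
        intro p hp
        rw [mem_badSet] at hp
        simp only [Finset.mem_filter, Finset.mem_univ, true_and]
        exact ⟨hp.1, fun t ht hsat => hp.2 (Ev.one t (hDF ht) hsat)⟩
      have hk1 : 1 ≤ i + 1 := by omega
      have hkc' : 2 * ((i + 1 : ℕ) : ℝ) ≤ c := by
        have : ((i + 1 : ℕ) : ℝ) ≤ k := by exact_mod_cast hik
        linarith
      have h1 := card_good_forall_not_satBy_le hexp hc hnV hM hk1 hkc' D hDdisj hDcons
        (fun t ht => hF t (hDF ht)) (fun t ht => hFV t (hDF ht))
      rw [hDcard] at h1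
      -- the numerical bound `(1 - x)^s ≤ exp(-s x) = exp(-T) ≤ 2^{-T}`
      set x : ℝ := ((2 : ℝ) ^ (i + 1 + 1))⁻¹ * ((M : ℝ) ^ (i + 1))⁻¹ with hx
      have hx0 : 0 ≤ x := by positivity
      have hx1 : x ≤ 1 := by
        have h2 : ((2 : ℝ) ^ (i + 1 + 1))⁻¹ ≤ 1 := inv_le_one_of_one_le₀ (one_le_pow₀ (by norm_num))
        have h3 : ((M : ℝ) ^ (i + 1))⁻¹ ≤ 1 :=
          inv_le_one_of_one_le₀ (one_le_pow₀ (by exact_mod_cast hM))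
        have h4 : (0 : ℝ) ≤ ((M : ℝ) ^ (i + 1))⁻¹ := by positivity
        calc x ≤ 1 * 1 := by rw [hx]; exact mul_le_mul h2 h3 h4 (by norm_num)
          _ = 1 := by ring
      have hsx : (s : ℝ) * x = T := by
        have h2 : (2 : ℝ) ^ (i + 1 + 1) ≠ 0 := by positivity
        have h3 : (M : ℝ) ^ (i + 1) ≠ 0 := pow_ne_zero _ (by exact_mod_cast (show M ≠ 0 by omega))
        calc (s : ℝ) * x
            = (T : ℝ) * ((2 : ℝ) ^ (i + 1 + 1) * ((2 : ℝ) ^ (i + 1 + 1))⁻¹) *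
                ((M : ℝ) ^ (i + 1) * ((M : ℝ) ^ (i + 1))⁻¹) := by
              rw [hs, hx, sPar]; push_cast; ring
          _ = T := by rw [mul_inv_cancel₀ h2, mul_inv_cancel₀ h3]; ring
      have hpow : (1 - x) ^ s ≤ ((2 : ℝ) ^ T)⁻¹ := by
        calc (1 - x) ^ s ≤ (Real.exp (-x)) ^ s :=
              pow_le_pow_left₀ (by linarith) (Real.one_sub_le_exp_neg x) s
          _ = Real.exp (-(T : ℝ)) := by rw [← Real.exp_nat_mul]; congr 1; rw [← hsx]; ring
          _ ≤ ((2 : ℝ) ^ T)⁻¹ := by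
              rw [Real.exp_neg]
              apply inv_anti₀ (by positivity)
              calc (2 : ℝ) ^ T ≤ (Real.exp 1) ^ T := by
                    apply pow_le_pow_left₀ (by norm_num)
                    have := Real.add_one_le_exp (1 : ℝ)
                    linarith
                _ = Real.exp (T : ℝ) := by rw [← Real.exp_nat_mul, mul_one]
      calc ((badSet (n := n) E r c V M F (hgt M (i + 1) T)).card : ℝ)
          ≤ (((Finset.univ : Finset ((Fin V → Fin M) × (Fin V → Bool))).filter
              fun p : (Fin V → Fin M) × (Fin V → Bool) =>
                Good (n := n) r c V M p.1 ∧ ∀ t ∈ D, ¬ SatBy (rho E r c V M p.1 p.2) t).card : ℝ) := by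
            exact_mod_cast Finset.card_le_card hsub
        _ ≤ (M : ℝ) ^ V * (2 : ℝ) ^ V * (1 - x) ^ s := h1
        _ ≤ (M : ℝ) ^ V * (2 : ℝ) ^ V * ((2 : ℝ) ^ T)⁻¹ := by gcongr
    · -- (b) a small cover: union bound over its assignments, induction hypothesis at target `T'`
      have hFβ : ∀ β : C → Bool, IsKDNF i (restrictDNF (extC C β) C F) := fun β => by
        have := isKDNF_restrictDNF hF hCcov (extC C β)
        simpa using this
      have hFβV : ∀ β : C → Bool, ∀ t ∈ restrictDNF (extC C β) C F, ∀ l ∈ t, l.1 < V := by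
        intro β t ht l hl
        unfold restrictDNF at ht
        obtain ⟨t₀, ht₀, rfl⟩ := Finset.mem_image.1 ht
        exact hFV t₀ (Finset.mem_filter.1 ht₀).1 l (Finset.mem_filter.1 hl).1
      -- a bad point for `F` is bad for some restricted DNF at height `hgt M i T'`
      have hsub : badSet (n := n) E r c V M F (hgt M (i + 1) T) ⊆
          (Finset.univ : Finset (C → Bool)).biUnion fun β =>
            badSet (n := n) E r c V M (restrictDNF (extC C β) C F) (hgt M i T') := by
        intro p hp
        rw [mem_badSet] at hp
        rw [Finset.mem_biUnion]
        by_contra hall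
        push Not at hall
        have hall' : ∀ β : C → Bool, Ev (restrictDNF (extC C β) C F) (rho E r c V M p.1 p.2) (hgt M i T') := by
          intro β
          by_contra hβ
          exact hall β (Finset.mem_univ β) (mem_badSet.2 ⟨hp.1, hβ⟩)
        have hev := ev_of_forall_restrictDNF hall'
        refine hp.2 (hev.mono ?_)
        rw [hH]
        have : C.card ≤ (i + 1) * s := hCcard
        omega
      have hCpow : ((Finset.univ : Finset (C → Bool)).card : ℝ) = (2 : ℝ) ^ C.card := by
        rw [Finset.card_univ, Fintype.card_fun, Fintype.card_bool, Fintype.card_coe]; push_cast; rfl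
      calc ((badSet (n := n) E r c V M F (hgt M (i + 1) T)).card : ℝ)
          ≤ (((Finset.univ : Finset (C → Bool)).biUnion fun β =>
              badSet (n := n) E r c V M (restrictDNF (extC C β) C F) (hgt M i T')).card : ℝ) := by
            exact_mod_cast Finset.card_le_card hsub
        _ ≤ ∑ β : C → Bool, ((badSet (n := n) E r c V M (restrictDNF (extC C β) C F) (hgt M i T')).card : ℝ) := by
            exact_mod_cast Finset.card_biUnion_le
        _ ≤ ∑ β : C → Bool, (M : ℝ) ^ V * (2 : ℝ) ^ V * ((2 : ℝ) ^ T')⁻¹ :=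
            Finset.sum_le_sum fun β _ => ih hi T' _ (hFβ β) (hFβV β)
        _ = (2 : ℝ) ^ C.card * ((M : ℝ) ^ V * (2 : ℝ) ^ V * ((2 : ℝ) ^ T')⁻¹) := by
            rw [Finset.sum_const, nsmul_eq_mul, hCpow]
        _ ≤ (2 : ℝ) ^ ((i + 1) * s) * ((M : ℝ) ^ V * (2 : ℝ) ^ V * ((2 : ℝ) ^ T')⁻¹) :=
            mul_le_mul_of_nonneg_right (pow_le_pow_right₀ (by norm_num) hCcard) (by positivity)
        _ = (M : ℝ) ^ V * (2 : ℝ) ^ V * (((2 : ℝ) ^ T)⁻¹ / 2) := by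
            rw [hT']
            have h2 : (2 : ℝ) ≠ 0 := by norm_num
            rw [pow_add, pow_add, pow_one]
            field_simp
        _ ≤ (M : ℝ) ^ V * (2 : ℝ) ^ V * ((2 : ℝ) ^ T)⁻¹ :=
            mul_le_mul_of_nonneg_left (half_le_self (by positivity)) (by positivity)

end Switching

end Summit.PneNP.PneNP.Theorems.ResKRestriction
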